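import Mathlib
import Summits.NavierStokesRegularity.FluidComputer.TransportGalerkinAbcSmoothKeep
import Summits.NavierStokesRegularity.FluidComputer.TransportGalerkinClassicalTransfer
import HarnessLib

/-!
# The forced-ABC KEEP word FOR CLASSICAL SOLUTIONS OF THE PERTURBED NAVIER–STOKES SYSTEM ON `𝕋³` (instab g20, cell `ns-blowup`, 2026-08-27)

HONEST FRAMING (human ruling D-0035): nothing here is a claim about Navier–Stokes blow-up.
WHAT THIS IS NOT: not NS evidence — a MODEL theorem (forced ABC flow on `𝕋³`, an `H²`-type growth
statement for classical solutions of its perturbation equation) whose load-bearing inputs are the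
Lyapunov certificates of record (interval stage not commissioned) and the certified X0 eigenvalue;
no number or census word moves. It says nothing about blow-up, about `ℝ³`, or about kinetic energy.

PURPOSE. The end of the g20 programme: the chain's KEEP word read on CLASSICAL SOLUTIONS OF THE PDE.
`TransportGalerkinAbcSmoothKeep.exists_keep_solution_abc_smooth` gives THE smooth lattice solution from
`ε • v` with its floor and its uniqueness among all spatially smooth classical solutions of the lattice
ODE keeping the clauses; `TransportGalerkinClassicalTransfer` shows that the scaled coefficient curve
`W s = Λ² 𝓕(u s)` of a space–time smooth classical solution `u` of the perturbation equation
`∂ₜu = νΔu − (U·∇)u − (u·∇)U − (u·∇)u − ∇q` about the host `U = abcFlow A B C` (divergence-free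
slices, zero mode `0`, smooth real pressures) IS such a solution. Hence
(`keep_of_classical_perturbation`): from the X0 row + certificate + gap/margin/window, the door's
eigenvector `v` and, for every such classical solution `u` on `ℝ × 𝕋³` with `Λ² 𝓕(u 0) = ε • v`:
`ε e^{μt}/2 ≤ ‖Λ² 𝓕(u t)‖_{ℓ²}` for every `t ∈ [0, T]` with `ε e^{μt} ≤ 2/(9C')` — the perturbation of
the forced ABC flow grows at the certified rate in the `H²`-type norm `‖Λ² 𝓕(·)‖_{ℓ²}`, modulo the
certificate. Mathlib + the tree files cited; no new definitions.
-/

noncomputable section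

open scoped ENNReal NNReal ComplexConjugate InnerProductSpace
open Set Filter Topology

namespace Summit.NavierStokesRegularity.FluidComputer.TransportGalerkinAbcClassicalKeep

open RCLike MeasureTheory UnitAddTorus
open Literature.Analysis.FunctionSpaces Literature.Analysis.FunctionSpaces.Lattice
open Literature.Analysis.FunctionSpaces.Torus Literature.Analysis.FunctionSpaces.EuclideanSpace
open Literature.Analysis.ODE Literature.Analysis.FluidPDE
open Summit.NavierStokesRegularity.FluidComputer.TransportGalerkin
open Summit.NavierStokesRegularity.FluidComputer.TransportGalerkinAbc
open Summit.NavierStokesRegularity.FluidComputer.TransportGalerkinAbcSmoothKeep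
open Summit.NavierStokesRegularity.FluidComputer.TransportGalerkinClassicalTransfer

/-- **KEEP for classical solutions of the perturbed forced-ABC system** (`keep_of_classical_perturbation`):
X0 row `Torus.IsLinNSEigenvalue ν (abcFlow A B C) μ` (`μ ≥ 0`, `ν > 0`) ⟹ the door's eigenvector `v` and,
for every window `T ≥ 0`, amplitude `ε > 0`, certificate (g18's list), gap `ω < 2μ`, margin `C'`, window
condition, and every `u : ℝ → 𝕋³ → ℝ³` smooth on `ℝ × 𝕋³` with divergence-free slices of vanishing zero
mode, solving on `(0, T)` the classical perturbation equation about `abcFlow A B C` with smooth real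
pressures `q t`, and starting at `Λ² 𝓕(u 0) = ε • v`: `ε e^{μt}/2 ≤ ‖Λ² 𝓕(u t)‖` for `t ∈ [0, T]` with
`ε e^{μt} ≤ 2/(9C')`. -/
theorem keep_of_classical_perturbation (K : ℕ) (A B C : ℝ) {ν μ : ℝ} (hν : 0 < ν) (hμ : 0 ≤ μ)
    (heig : Torus.IsLinNSEigenvalue ν (Torus.abcFlow A B C) (μ : ℂ)) :
    ∃ v : lp (fun _ : (Fin 3 → ℤ) => EuclideanSpace ℂ (Fin 3)) 2,
      ‖v‖ = 1 ∧ RapidDecay (⇑v) ∧ (∀ k, lerayCLM k (v k) = v k) ∧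
      (∀ (j : Fin 3) (k : Fin 3 → ℤ), (EuclideanSpace.proj j : EuclideanSpace ℂ (Fin 3) →L[ℂ] ℂ) (v (-k)) =
        conj ((EuclideanSpace.proj j : EuclideanSpace ℂ (Fin 3) →L[ℂ] ℂ) (v k))) ∧
      (∀ k : Fin 3 → ℤ, ∑ j, ((k j : ℤ) : ℂ) * (EuclideanSpace.proj j : EuclideanSpace ℂ (Fin 3) →L[ℂ] ℂ) (v k) = 0) ∧
      linOp ν (mFourierCoeff (complexify ∘ Torus.abcFlow A B C))
          (fun j => (EuclideanSpace.proj j : EuclideanSpace ℂ (Fin 3) →L[ℂ] ℂ)) lerayCLM v = μ • v ∧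
      ∀ {T : ℝ} (hT : 0 ≤ T) {ε : ℝ} (hε : 0 < ε)
        {μt : ℝ}
        {G₁ G₂ G : lp (fun _ : (Fin 3 → ℤ) => EuclideanSpace ℂ (Fin 3)) 2 →L[ℝ]
          lp (fun _ : (Fin 3 → ℤ) => EuclideanSpace ℂ (Fin 3)) 2}
        (hG₁ : ∀ x y : lp (fun _ : (Fin 3 → ℤ) => EuclideanSpace ℂ (Fin 3)) 2, ⟪G₁ x, y⟫_ℂ = ⟪x, G₁ y⟫_ℂ)
        (hG₂ : ∀ x y : lp (fun _ : (Fin 3 → ℤ) => EuclideanSpace ℂ (Fin 3)) 2, ⟪G₂ x, y⟫_ℂ = ⟪x, G₂ y⟫_ℂ)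
        (hG : ∀ x y : lp (fun _ : (Fin 3 → ℤ) => EuclideanSpace ℂ (Fin 3)) 2, ⟪G x, y⟫_ℂ = ⟪x, G y⟫_ℂ)
        (hG₁P : ∀ n, ∀ w z : lp (fun _ : (Fin 3 → ℤ) => EuclideanSpace ℂ (Fin 3)) 2,
          ⟪G₁ w, cubeProj (n + K) z⟫_ℂ = ⟪G₁ (cubeProj (n + K) w), z⟫_ℂ)
        (hG₂P : ∀ n, ∀ w z : lp (fun _ : (Fin 3 → ℤ) => EuclideanSpace ℂ (Fin 3)) 2,
          ⟪G₂ w, cubeProj (n + K) z⟫_ℂ = ⟪G₂ (cubeProj (n + K) w), z⟫_ℂ)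
        (hGP : ∀ n, ∀ w z : lp (fun _ : (Fin 3 → ℤ) => EuclideanSpace ℂ (Fin 3)) 2,
          ⟪G w, cubeProj (n + K) z⟫_ℂ = ⟪G (cubeProj (n + K) w), z⟫_ℂ)
        (hG₁pos : ∀ x : lp (fun _ : (Fin 3 → ℤ) => EuclideanSpace ℂ (Fin 3)) 2, 0 ≤ re ⟪G₁ x, x⟫_ℂ)
        {ω c m₂ M₁ : ℝ} (hc : 0 < c) (hm₂ : 0 < m₂) (hM₁ : 0 ≤ M₁)
        (hm₂' : ∀ x : lp (fun _ : (Fin 3 → ℤ) => EuclideanSpace ℂ (Fin 3)) 2, m₂ * ‖x‖ ^ 2 ≤ re ⟪G₂ x, x⟫_ℂ)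
        (hM₁' : ∀ x : lp (fun _ : (Fin 3 → ℤ) => EuclideanSpace ℂ (Fin 3)) 2,
          re ⟪G₁ x, x⟫_ℂ ≤ M₁ * (eNormSq (-1) (⇑x)).toReal)
        {m M ω₁ : ℝ} (hm0 : 0 < m)
        (hm : ∀ x : lp (fun _ : (Fin 3 → ℤ) => EuclideanSpace ℂ (Fin 3)) 2, m * ‖x‖ ^ 2 ≤ re ⟪G x, x⟫_ℂ)
        (hM : ∀ x : lp (fun _ : (Fin 3 → ℤ) => EuclideanSpace ℂ (Fin 3)) 2, re ⟪G x, x⟫_ℂ ≤ M * ‖x‖ ^ 2)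
        (h₁ : ∀ n, ∀ w : lp (fun _ : (Fin 3 → ℤ) => EuclideanSpace ℂ (Fin 3)) 2,
          2 * re ⟪G₁ (cubeProj (n + K) w), linOp ν (mFourierCoeff (EuclideanSpace.complexify ∘ Torus.abcFlow A B C))
            (fun j => (EuclideanSpace.proj j : EuclideanSpace ℂ (Fin 3) →L[ℂ] ℂ)) lerayCLM (cubeProj (n + K) w)⟫_ℂ +
            c * re ⟪G₂ (cubeProj (n + K) w), cubeProj (n + K) w⟫_ℂ ≤ 2 * ω * re ⟪G₁ (cubeProj (n + K) w), cubeProj (n + K) w⟫_ℂ)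
        (h₂ : ∀ n, ∀ w : lp (fun _ : (Fin 3 → ℤ) => EuclideanSpace ℂ (Fin 3)) 2,
          re ⟪G₂ (cubeProj (n + K) w), linOp ν (mFourierCoeff (EuclideanSpace.complexify ∘ Torus.abcFlow A B C))
            (fun j => (EuclideanSpace.proj j : EuclideanSpace ℂ (Fin 3) →L[ℂ] ℂ)) lerayCLM (cubeProj (n + K) w)⟫_ℂ ≤
            ω * re ⟪G₂ (cubeProj (n + K) w), cubeProj (n + K) w⟫_ℂ)
        (hL : ∀ n, ∀ w : lp (fun _ : (Fin 3 → ℤ) => EuclideanSpace ℂ (Fin 3)) 2,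
          re ⟪G (cubeProj (n + K) w), linOp ν (mFourierCoeff (EuclideanSpace.complexify ∘ Torus.abcFlow A B C))
            (fun j => (EuclideanSpace.proj j : EuclideanSpace ℂ (Fin 3) →L[ℂ] ℂ)) lerayCLM (cubeProj (n + K) w)⟫_ℂ ≤
            ω₁ * re ⟪G (cubeProj (n + K) w), cubeProj (n + K) w⟫_ℂ)
        (hμ₁ : μt ≤ ω₁) (hμ₂ : μt ≤ ω)
        (htail : ∀ n, ∀ q : lp (fun _ : (Fin 3 → ℤ) => EuclideanSpace ℂ (Fin 3)) 2, cubeProj (n + K) q = 0 →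
          2 * μt * re ⟪G₁ q, q⟫_ℂ + c * re ⟪G₂ q, q⟫_ℂ ≤ 2 * ω * re ⟪G₁ q, q⟫_ℂ)
        (hgap : ω < 2 * μ)
        {C' : ℝ}
        (hCC' : Real.sqrt (M₁ / (c * m₂)) * (2 * ((Fintype.card (Fin 3) : ℝ) * (2 * Real.pi)) *
            Real.sqrt ((∑' l : Fin 3 → ℤ, ENNReal.ofReal (sobolevWeight (-2) l ^ 2)).toReal)) *
            Real.sqrt (Real.pi / (2 * μ - ω)) < C')
        (hsmall : ∀ t ∈ Icc 0 T, C' * (3 / 2 : ℝ) ^ 2 * (ε * Real.exp (μ * t)) < 3 / 2 - 1)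
        -- every classical solution of the perturbed system from `ε • v`
        {u : ℝ → UnitAddTorus (Fin 3) → EuclideanSpace ℝ (Fin 3)} (_hu : IsSmoothSpaceTimeOn univ u)
        (_hdiv : ∀ s, IsDivFree (u s)) (_h0 : ∀ s, mFourierCoeff (complexify ∘ u s) 0 = 0)
        {q : ℝ → UnitAddTorus (Fin 3) → ℝ} (_hq : ∀ t ∈ Ioo 0 T, IsSmooth (q t))
        (_heq : ∀ t ∈ Ioo 0 T, ∀ y, Torus.timeDeriv u t y = ν • laplacian (u t) y
          - (Torus.convect (Torus.abcFlow A B C) (u t) y + Torus.convect (u t) (Torus.abcFlow A B C) y)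
          - Torus.convect (u t) (u t) y - Torus.gradient (q t) y)
        (_hinit : (ofCoeff (wmul 2 (mFourierCoeff (complexify ∘ u 0))) : lp (fun _ : (Fin 3 → ℤ) => EuclideanSpace ℂ (Fin 3)) 2) = ε • v)
        {t : ℝ} (_ht : t ∈ Icc 0 T) (_hχ : ε * Real.exp (μ * t) ≤ 2 / (9 * C')),
        ε * Real.exp (μ * t) / 2 ≤ ‖(ofCoeff (wmul 2 (mFourierCoeff (complexify ∘ u t))) : lp (fun _ : (Fin 3 → ℤ) => EuclideanSpace ℂ (Fin 3)) 2)‖ := by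
  obtain ⟨v, hv1, hvr, hvP, hvreal, hvdiv, hAv, H⟩ := exists_keep_solution_abc_smooth K A B C hν hμ heig
  refine ⟨v, hv1, hvr, hvP, hvreal, hvdiv, hAv, ?_⟩
  intro T hT ε hε μt G₁ G₂ G hG₁ hG₂ hG hG₁P hG₂P hGP hG₁pos ω c m₂ M₁ hc hm₂ hM₁ hm₂' hM₁' m M ω₁ hm0 hm hM h₁ h₂
    hL hμ₁ hμ₂ htail hgap C' hCC' hsmall u hu hdiv h0 q hq heq hinit t ht hχ
  obtain ⟨w, -, -, -, -, -, -, -, -, hfloor, huniq⟩ := H hT hε hG₁ hG₂ hG hG₁P hG₂P hGP hG₁pos hc hm₂ hM₁ hm₂'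
    hM₁' hm0 hm hM h₁ h₂ hL hμ₁ hμ₂ htail hgap hCC' hsmall
  -- the coefficient curve of `u` is a spatially smooth lattice solution with the clauses
  have hsmoothU : IsSmooth (Torus.abcFlow A B C) := Torus.isSmooth_abcFlow A B C
  have heqOn : EqOn (fun s => (ofCoeff (wmul 2 (mFourierCoeff (complexify ∘ u s))) : lp (fun _ : (Fin 3 → ℤ) => EuclideanSpace ℂ (Fin 3)) 2)) w (Icc 0 T) :=
    huniq (continuous_coeffCurve hu).continuousOn hinit
      (fun s hs => hasDerivAt_coeffCurve_nsField hsmoothU hu hdiv h0 (hq s hs) (heq s hs))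
      (fun s _ => rapidDecay_coeffCurve hu s)
      (fun s _ => (coeffCurve_clauses hu hdiv h0 s).1)
      (fun s _ => (coeffCurve_clauses hu hdiv h0 s).2.1)
      (fun s _ => (coeffCurve_clauses hu hdiv h0 s).2.2)
  have h := hfloor t ht hχ
  rw [← heqOn ht] at h
  exact h

end Summit.NavierStokesRegularity.FluidComputer.TransportGalerkinAbcClassicalKeep

end
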